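import Summits.Ventures.HSemireg.PerfectComplexRankDoor
import Literature.AlgebraicGeometry.HodgeTheory.DirectImageBaseChangeContinuous
import Literature.AlgebraicGeometry.HodgeTheory.DirectImageBaseChangeSections
import Literature.AlgebraicGeometry.FundamentalGroup.RiemannExistenceEtaleLocalHomeomorph
import HarnessLib

/-!
# Venture HSemireg — the ALGEBRAISATION / SPREAD step of the perfect-complex door, in the kernel: «an algebraic
# deformation of `E₀` over an étale neighbourhood (or a smooth chart) of `s₀` ⟹ its `ch` stays algebraic nearby» (proved)

HONEST FRAMING. Part of the Lean index of the computation cell `pub-hsemireg` (theory seat 3: «the algebraisation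
step»). Nothing here is a claim about any explicit variety; nothing here says HC, HC_CM or HC_AV is proved. No Literature
fact is declared; no `sorry`; no new axiom. TWO definitions (assumptions BY NAME, each IMPLYING seat p4's door) and theorems.

## What this file does to the trust base of route (C)

Seat p4's door `PerfectComplexVariationalHodge C Adm` (`PerfectComplexDoor.lean`; at `Adm := rankAdmissible C` it is
`PerfectComplexRankTransfer C`, the ONE transfer hypothesis BY NAME of the g = 4 route-(C) theorems) renders as ONE named
assumption the whole of the refereed derivation of record `theory/TH2-ASSEMBLY-NOTE-2PAGE.md` §3: its LOCAL half (L1)–(L6)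
— the moduli of perfect complexes `𝓜 → S` is smooth at `[E₀]` ([Lieblich2006] Thm. 4.2.1; [Pridham2024Semiregularity]
Cor. 2.25, Rem. 2.27, Rem. 2.21; [BuchweitzFlenner2003] Rem. 4.7 (1); [Deligne1968] Thm. 5.5) — AND the passage from that
smoothness to «the classes are algebraic on the nearby fibres» (a chart of `𝓜` through `[E₀]`, a local section, the
universal complex restricted to fibres, flatness of `ch` of a global object, algebraicity of `ch` on a smooth projective
fibre: p4's on-paper «DERIVATION OF THE LOCAL FORM» = the last sentence of Buchweitz–Flenner's proof of Thm. 5.1, «hence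
`α_p(s) = ch_p(ℱ|X_s)` is algebraic for all `s` near `0`»; theory seat 2's note does it GLOBALLY via [Perry2022] Prop. 8.1,
which the LOCAL door does not need). The second passage is Hodge theory on the tree's REAL carriers; this file PROVES it.

* §2 `PerfectComplexDeformsOverSmoothChart C Adm` (def) — binders of p4's schema VERBATIM; conclusion: a smooth
  `ℂ`-scheme `T`, `ρ : T ⟶ S`, an open `W`, `s₀ ∈ W ⊆ U`, a continuous SECTION `σ : W → T(ℂ)` of `ρ(ℂ)`, and a bounded
  complex of vector bundles `ℰ` on `𝒳 ×_S T` (the tree's `familyPullback`) whose `ch_p`, restricted to the fibre over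
  `σ(s₀)` and carried to `𝒳_{s₀}`, is `(e⁻¹)^*κ_p`, `p ∈ I`.
* §2b `PerfectComplexDeformsOverEtaleNbhd C Adm` (def) — the same with `ρ` ÉTALE and a point `t₀ ∈ T(ℂ)` over `s₀`
  instead of the section: the PRINTED conclusion shape (REFEREED: [Perry2022] proof of Prop. 8.1, «a surjective étale
  `U′ → U` with `0′ ↦ 0` such that `𝓜°_{U′} → U′` admits a section taking `0′` to `E_{0′}`» — the typed shape DROPS
  «surjective» and fixes only the CLASSES `ch_p`, `p ∈ I`, at `t₀`: WEAKER than print; preprint: Perry 2026 Thm. 1.1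
  bullet 1, untwisted here; BF's own 5.1 proof outputs an ANALYTIC section = the §2 shape). PROVED `….deformsOverSmoothChart`
  (an étale `ρ(ℂ)` is a local homeomorphism, tree theorem `isLocalHomeomorph_map_of_etale` = SGA 1 XII 3.1 (iii); its
  local inverse is the section; `T` is smooth over `ℂ` as étale over the smooth `S`).
* §1 (PROVED, deformation-free) `transportFun_eq_clsAt_baseChange_globalSection`: for ANY `ρ : T ⟶ S` between smooth
  `ℂ`-schemes, any continuous section `σ` of `ρ(ℂ)` over `W` and any class `A` on `𝒳 ×_S T`, the flat transport
  inside `W` of the `s`-value of `w ↦ A|_{(𝒳 ×_S T)_{σ w}}` (carried to `𝒳_w`) is its `t`-value — Ehresmann for `π` and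
  for its base change, continuity of the transfer of fibre classes along ANY base change, flat global sections,
  uniqueness of lifts (tree theorems, named in the proof); and `transportFun_mem_algebraicClasses_of_baseChange_chPerfect`:
  with `A = ch_p(ℰ)` the transport is `ch_p` of `ℰ` restricted to a (smooth projective) fibre of `𝒳 ×_S T`, hence
  ALGEBRAIC (p4's `map_chPerfect`, `chPerfect_mem_algebraicClasses`).
* §3 (PROVED) `PerfectComplexDeformsOver{SmoothChart,EtaleNbhd}.perfectComplexVariationalHodge`: either assumption
  IMPLIES p4's door, for every `Adm`; `….perfectComplexRankTransfer`: `PerfectComplexRankTransfer C` at `rankAdmissible C`.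
* §4 (PROVED, no assumption) `perfectComplexVariationalHodge_conclusion_of_global`: a bounded complex of vector
  bundles on `𝒳` ITSELF with the right `ch` at `s₀` gives the door's conclusion with `W = U`.

HONEST WORDS. The new assumptions IMPLY p4's (logically STRONGER, upstream): a RELOCATION of the named assumption to
exactly where the deformation theory ends (in its printed shape), with a kernel proof of everything Hodge-theoretic
downstream — not a weakening of the trust base. Monday sentence for route (C), if adopted: transfer = «local algebraic
deformation over an étale neighbourhood of `s₀` (assumption BY NAME `PerfectComplexDeformsOverEtaleNbhd C (rankAdmissible C)`;
refereed derivation on paper) + SPREAD (kernel: étale ⟹ chart with section ⟹ p4's door)». WORDING RULE W-4 (red-5 v8):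
print BOTH names, «`hT : PerfectComplexRankTransfer C` (consumed) ⟸ `hD : PerfectComplexDeformsOverEtaleNbhd C (rankAdmissible C)`
(assumed, printed étale SHAPE)»; `hD ⟹ hT` is kernel (§3), `hT ⟹ hD` is NOT claimed (F-1 applies at the new location).

## Derivation of the assumptions for the intended `Adm` (NOT kernel-linked; FULL semiregularity, `Ext^{<0} = 0`, simple)

(L1)–(L6) (`theory/TH2-ASSEMBLY-NOTE-2PAGE.md` §3; locators re-read there and by referees ref g10 / ref-2 / ref-3):
`𝓜 = 𝒟^b_{pug}(𝒳/S)` is an Artin stack l.f.p. over `S` [Lieblich2006, Thm. 4.2.1] and `𝓜 → S` is smooth at `[E₀]`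
when `Ext^{<0}(E₀,E₀) = 0`, the full semiregularity map of `E₀` is injective and `ch_p(E₀)` stays in `F^p` horizontally
for `1 ≤ p ≤ n` over the REDUCED `S` ([Pridham2024Semiregularity] Cor. 2.25 + Rem. 2.27, Rem. 2.21;
[BuchweitzFlenner2003] Rem. 4.7 (1); [Deligne1968] Thm. 5.5). Take a smooth atlas `V → 𝓜` and a `ℂ`-point `v₀` over
`[E₀]`; `V → S` is smooth at `v₀`; shrink to an affine `T ∋ t₀ := v₀` smooth over `S` (its image lies in the OPEN image
`U° ⊆ S` of the smooth locus `𝓜°` — Perry's `U`). Étale form: an étale quasi-section `S' → T` through `t₀` with `S' → S`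
étale [EGAIV4, Cor. 17.16.3 (i)] (separability void: all points are `ℂ`-points; item (ii) is the surjective global
form, not used — red-2 R202 / ref-3 P2). Strictification: the universal object on `𝒳 ×_S T` is `T`-perfect, hence perfect
(`𝒳 ×_S T` regular), hence — `𝒳 ×_S T` being quasi-projective over `ℂ` — quasi-isomorphic to a bounded complex `ℰ` of
finite locally free modules [ThomasonTrobaugh1990, Prop. 2.3.1 (d)]; `ℰ` restricted to the fibre over `t₀` is
quasi-isomorphic to `E₀` carried along `X₀ ≅ 𝒳_{s₀} ≅ (𝒳 ×_S T)_{t₀}`, so the Chern characters agree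
(`chPerfect_eq_of_quasiIso`, `map_chPerfect` — kernel facts of p4). CLASS LEVEL (red-4 v8): Perry's `φ` is a section of
`K₀^top(𝒞/S)`; the tree carries the Betti classes `(ch_p)_{p ∈ I}` only — the direction used, object ⟹ class, is the
harmless one. Chart form directly: `ρ(ℂ)` is a holomorphic submersion at `t₀`, so a holomorphic section exists on a
ball `W' ∋ s₀` [VoisinHodgeI2002, §9.1.1]; `W := W' ∩ U`. The kernel sees the conclusion SHAPE only (wording rule F-1).

## References

[Lieblich2006] M. Lieblich, J. Algebraic Geom. 15 (2006), Thm. 4.2.1 · [Pridham2024Semiregularity] J. P. Pridham, Forum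
Math. Sigma 12 (2024) e126, Cor. 2.25, Rem. 2.27, Rem. 2.21 · [BuchweitzFlenner2003] R.-O. Buchweitz, H. Flenner,
Compositio Math. 137 (2003), Rem. 4.7 (1), Thm. 5.1 and its proof (p. 179) · [Deligne1968] P. Deligne, Publ. Math. IHÉS 35
(1968), Thm. 5.5 · [ThomasonTrobaugh1990] R. W. Thomason, T. Trobaugh, Grothendieck Festschrift III (1990), Prop. 2.3.1 (d)
· [EGAIV4] ÉGA IV_4, Publ. Math. IHÉS 32 (1967), Cor. 17.16.3 (i) (p. 106) · [SGA1] SGA 1, Exp. XII Prop. 3.1 (iii) (via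
the tree's `isLocalHomeomorph_map_of_etale`) · [Perry2022] A. Perry, Compositio Math. 158 (2022), proof of Prop. 8.1,
p. 28 (the étale-neighbourhood SHAPE; the GLOBAL statement is not needed here) · [Perry2026Semiregularity]
arXiv:2604.00511, Thm. 1.1 (shape only; claim-grade, not used) · [VoisinHodgeII2003] C. Voisin, vol. II, §3.1.1–3.1.2
(via the tree's `DirectImageBaseChange*`); [VoisinHodgeI2002] vol. I, §9.1.1, §9.2.1 · [Fulton1998] W. Fulton,
Intersection Theory, §15.1 (ii), Prop. 19.1.2 (via p4's `map_chPerfect`, `chPerfect_mem_algebraicClasses`).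
-/

noncomputable section

open CategoryTheory CategoryTheory.Limits AlgebraicGeometry
open _root_.Topology _root_.Filter
open Literature.AlgebraicGeometry.Motives Literature.AlgebraicGeometry.HodgeTheory
open Literature.AlgebraicGeometry.KTheory
open Literature.AlgebraicTopology.SingularHomology

namespace Summit.Ventures.HSemireg

/-! ### §1 Transport along a section of a base change (deformation-free Hodge theory, proved) -/

section Transport

variable {𝒳 S T : SchemeOver ℂ} (π : 𝒳 ⟶ S) (ρ : T ⟶ S)

/-- **Transport along a section of a base change.** `π : 𝒳 ⟶ S` smooth projective over a smooth `S`, `ρ : T ⟶ S`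
any morphism from a smooth `T`, `σ : W → T(ℂ)` a continuous section of `ρ(ℂ)` over `W ⊆ S(ℂ)`, `A` a class on
`𝒳 ×_S T`: if the fibre class of `A` over `σ(s)`, carried to `𝒳_s`, is `(s, α)`, then the transport of `α` along any
path `γ` in `W` from `s` to `t` is the fibre class of `A` over `σ(t)` carried to `𝒳_t` — the path
`u ↦ (γ u, A|_{σ(γ u)})` of fibre classes is continuous (Ehresmann for `π` and its base change; continuity of the
transfer along ANY base change; continuity of global sections) and lies over `γ`, so it IS the lift computing the
transport. «The uniqueness of the horizontal lifting gives that `α_p = ch_p(ℱ)`» — over a chart of the base.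
[cite: BuchweitzFlenner2003, §5, proof of Thm. 5.1] [cite: VoisinHodgeII2003, §3.1.2] -/
theorem transportFun_eq_clsAt_baseChange_globalSection {n : ℕ} (hπ : IsSmoothProjectiveFamily π n)
    [_root_.AlgebraicGeometry.Smooth S.hom] [_root_.AlgebraicGeometry.Smooth T.hom]
    {W : Set (ComplexPoints S)} (hW : IsCohomologicallyLocallyTrivialOn π W)
    (σ : C(W, ComplexPoints T)) (hσ : ∀ w : W, AlgPoints.map ρ (σ w) = w.1)
    (k : ℕ) (A : complexBetti (familyPullback π ρ) k) {s t : W} (γ : Path.Homotopic.Quotient s t)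
    {α : complexBetti (fiberOver π s.1) k}
    (h₀ : FiberClass.baseChange π ρ k (globalSection (familyPullback.snd π ρ) k A (σ s)) = ⟨s.1, α⟩) :
    transportFun π k hW γ α =
      (FiberClass.baseChange π ρ k (globalSection (familyPullback.snd π ρ) k A (σ t))).clsAt (hσ t) := by
  have hU : IsCohomologicallyLocallyTrivialOn π Set.univ := -- Ehresmann for `π` and for `π' : 𝒳 ×_S T ⟶ T`
    isCohomologicallyLocallyTrivialOn_univ_of_isSmoothProjectiveFamily_of_smooth π hπ
  have hU' : IsCohomologicallyLocallyTrivialOn (familyPullback.snd π ρ) Set.univ :=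
    isCohomologicallyLocallyTrivialOn_univ_of_isSmoothProjectiveFamily_of_smooth (familyPullback.snd π ρ)
      (hπ.familyPullback_snd (g := ρ))
  induction γ using Quotient.ind with | _ γ =>
  have hpt : (FiberClass.baseChange π ρ k (globalSection (familyPullback.snd π ρ) k A (σ t))).pt = t.1 := hσ t
  -- the lift of `γ`: `u ↦` the fibre class of `A` over `σ(γ u)`, carried to `𝒳_{γ u}`
  have hcont : Continuous fun u : unitInterval =>
      FiberClass.baseChange π ρ k (globalSection (familyPullback.snd π ρ) k A (σ (γ u))) :=
    (FiberClass.continuous_baseChange_of_isCohomologicallyLocallyTrivialOn π ρ hU hU' k).comp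
      ((continuous_globalSection (familyPullback.snd π ρ) k A).comp (σ.continuous.comp γ.continuous))
  let Γ : Path (⟨s.1, α⟩ : FiberClass π k)
      ⟨t.1, (FiberClass.baseChange π ρ k (globalSection (familyPullback.snd π ρ) k A (σ t))).clsAt hpt⟩ :=
    { toFun := fun u => FiberClass.baseChange π ρ k (globalSection (familyPullback.snd π ρ) k A (σ (γ u)))
      continuous_toFun := hcont
      source' := by rw [γ.source, h₀]
      target' := by rw [FiberClass.mk_clsAt, γ.target] }
  exact transportFun_eq_of_path π k hW γ Γ fun u => hσ (γ u)

/-- **The fibre class of `ch_p(ℰ)` over `t'`, carried to `𝒳_{ρ t'}` and viewed in `𝒳_s`, `s = ρ(t')`, is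
ALGEBRAIC**: it is `ch_p` of the (termwise) restriction of `ℰ` along `𝒳_{ρ t'} ≅ (𝒳 ×_S T)_{t'} ⟶ 𝒳 ×_S T`, a smooth
projective variety (p4's `map_chPerfect`, `chPerfect_mem_algebraicClasses`). [cite: Fulton1998, §15.1 (ii), Prop. 19.1.2] -/
theorem clsAt_baseChange_globalSection_chPerfect_mem_algebraicClasses (C : ChernCharacterBetti) {n : ℕ}
    (hπ : IsSmoothProjectiveFamily π n) (ℰ : CochainComplex (familyPullback π ρ).left.Modules ℤ)
    (hℰ : IsBoundedVBComplex ℰ) (p : ℕ) (t' : ComplexPoints T) {s : ComplexPoints S}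
    (h : AlgPoints.map ρ t' = s) :
    (FiberClass.baseChange π ρ (2 * p)
        (globalSection (familyPullback.snd π ρ) (2 * p)
          (chPerfect C (familyPullback π ρ) ℰ hℰ.isFiniteLocallyFree p) t')).clsAt h ∈
      algebraicClasses (fiberOver π s) p := by
  subst h
  change complexBetti.map (fiberOverFamilyPullbackIso π ρ t').inv (2 * p)
      (complexBetti.map (fiberι (familyPullback.snd π ρ) t') (2 * p)
        (chPerfect C (familyPullback π ρ) ℰ hℰ.isFiniteLocallyFree p)) ∈
    algebraicClasses (fiberOver π (AlgPoints.map ρ t')) p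
  rw [map_chPerfect C (familyPullback π ρ) _ hℰ p, map_chPerfect C _ _ (hℰ.pullback _) p]
  exact chPerfect_mem_algebraicClasses C _ (hπ.isSmoothProjective (AlgPoints.map ρ t')) _ _ p

/-- **Corollary: the transport is `ch_p` of a restricted complex, hence ALGEBRAIC** — with `A = ch_p(ℰ)` for a
bounded complex of vector bundles `ℰ` on `𝒳 ×_S T`, the transport of `α` along every path in `W` is `ch_p` of `ℰ`
restricted to a (smooth projective) fibre of `𝒳 ×_S T`, carried along an isomorphism onto a fibre of `π`. «Hence
`α_p(s) = ch_p(ℱ|X_s)` is algebraic for all `s ∈ S` near `0`.» [cite: BuchweitzFlenner2003, §5, proof of Thm. 5.1]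
[cite: Fulton1998, §15.1 (ii) and Prop. 19.1.2] -/
theorem transportFun_mem_algebraicClasses_of_baseChange_chPerfect (C : ChernCharacterBetti) {n : ℕ}
    (hπ : IsSmoothProjectiveFamily π n)
    [_root_.AlgebraicGeometry.Smooth S.hom] [_root_.AlgebraicGeometry.Smooth T.hom]
    {W : Set (ComplexPoints S)} (hW : IsCohomologicallyLocallyTrivialOn π W)
    (σ : C(W, ComplexPoints T)) (hσ : ∀ w : W, AlgPoints.map ρ (σ w) = w.1)
    (ℰ : CochainComplex (familyPullback π ρ).left.Modules ℤ) (hℰ : IsBoundedVBComplex ℰ) (p : ℕ)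
    {s t : W} (γ : Path.Homotopic.Quotient s t) {α : complexBetti (fiberOver π s.1) (2 * p)}
    (h₀ : FiberClass.baseChange π ρ (2 * p)
        (globalSection (familyPullback.snd π ρ) (2 * p)
          (chPerfect C (familyPullback π ρ) ℰ hℰ.isFiniteLocallyFree p) (σ s)) = ⟨s.1, α⟩) :
    transportFun π (2 * p) hW γ α ∈ algebraicClasses (fiberOver π t.1) p := by
  rw [transportFun_eq_clsAt_baseChange_globalSection π ρ hπ hW σ hσ (2 * p) _ γ h₀]
  exact clsAt_baseChange_globalSection_chPerfect_mem_algebraicClasses π ρ C hπ ℰ hℰ p (σ t) (hσ t)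

end Transport

/-! ### §2 The assumption BY NAME: local existence of an algebraic deformation over a smooth chart -/

section Chart

/-- **Local existence of an algebraic deformation of an admissible perfect complex over a smooth chart of the
base** (schema in `Adm`; assumption BY NAME — the OUTPUT of the refereed chain (L1)–(L6) of
`theory/TH2-ASSEMBLY-NOTE-2PAGE.md` §3 + smooth atlas + strictification + a local section; also the shape Buchweitz–Flenner's
proof of Thm. 5.1 produces for sheaves, p. 179: an analytic section of the versal base by Artin approximation). Binders =
seat p4's `PerfectComplexVariationalHodge C Adm` VERBATIM; conclusion: a smooth `ℂ`-scheme `T`, `ρ : T ⟶ S`, an open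
`W`, `s₀ ∈ W ⊆ U`, a continuous section `σ : W → T(ℂ)` of `ρ(ℂ)` (continuity is all the spread uses; in particular a
HOLOMORPHIC section — Buchweitz–Flenner's analytic one — is an instance), and a bounded complex of vector bundles `ℰ` on
`𝒳 ×_S T` such that for `p ∈ I` the fibre class of `ch_p(ℰ)` over `σ(s₀)`, carried to `𝒳_{s₀}`, is `(s₀, (e⁻¹)^* κ_p)`
(`ℰ|_{(𝒳 ×_S T)_{σ s₀}}` has the Chern character of `E₀` in the degrees `I`). For the INTENDED `Adm` (FULL semiregularity,
`Ext^{<0} = 0`, simple, `{1,…,n} ⊆ I` — seat t-7's `sigmaAdmissible` of `PerfectComplexSigmaDoor.lean` is this notion on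
real carriers) and for `rankAdmissible C` this holds on paper from the refereed sources; the kernel
links it to nothing. SCOPE (theory seat 2): the Hodge binder puts `U` INSIDE the Hodge locus of `κ` — that is what
makes «`𝓜 → S` smooth at `[E₀]`» literal (in general the moduli map is smooth onto the Hodge locus, not onto `S`); in
route (C) `S` is the special family on which the class is Hodge everywhere, so the binder is met by construction. It
implies p4's door (§3) and is implied by the printed étale shape (§2b).
[cite: Lieblich2006, Thm. 4.2.1] [cite: Pridham2024Semiregularity, Cor. 2.25, Rem. 2.27, Rem. 2.21]
[cite: BuchweitzFlenner2003, Rem. 4.7 (1) and §5, proof of Thm. 5.1] [cite: Deligne1968, Thm. 5.5]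
[cite: ThomasonTrobaugh1990, Prop. 2.3.1 (d)] [claim: Perry2026Semiregularity, status: under-review] -/
def PerfectComplexDeformsOverSmoothChart (C : ChernCharacterBetti) (Adm : AdmissibilityNotion) : Prop :=
  ∀ ⦃𝒳 S : SchemeOver ℂ⦄ (π : 𝒳 ⟶ S) (n : ℕ),
    IsSmoothProjectiveFamily π n → _root_.AlgebraicGeometry.Smooth S.hom →
    ∀ ⦃U : Set (ComplexPoints S)⦄ (hU : IsCohomologicallyLocallyTrivialOn π U) (s₀ : U)
      (X₀ : SchemeOver ℂ) (e : X₀ ≅ fiberOver π s₀.1)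
      (κ : ∀ p : ℕ, complexBetti X₀ (2 * p)) (I : Finset ℕ),
      perfectObjClass C Adm n X₀ I κ →
      (∀ p ∈ I, ∀ (t : U) (γ : Path.Homotopic.Quotient s₀ t),
          IsOfHodgeType n (fiberOver π t.1) (2 * p) p p
            (transportFun π (2 * p) hU γ (complexBetti.map e.inv (2 * p) (κ p)))) →
      ∃ (T : SchemeOver ℂ) (ρ : T ⟶ S) (_ : _root_.AlgebraicGeometry.Smooth T.hom)
        (W : Set (ComplexPoints S)) (_ : IsOpen W) (hW₀ : s₀.1 ∈ W) (_ : W ⊆ U)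
        (σ : C(W, ComplexPoints T)) (_ : ∀ w : W, AlgPoints.map ρ (σ w) = w.1)
        (ℰ : CochainComplex (familyPullback π ρ).left.Modules ℤ) (hℰ : IsBoundedVBComplex ℰ),
        ∀ p ∈ I,
          FiberClass.baseChange π ρ (2 * p)
              (globalSection (familyPullback.snd π ρ) (2 * p)
                (chPerfect C (familyPullback π ρ) ℰ hℰ.isFiniteLocallyFree p) (σ ⟨s₀.1, hW₀⟩)) =
            ⟨s₀.1, complexBetti.map e.inv (2 * p) (κ p)⟩

variable {C : ChernCharacterBetti} {Adm Adm' : AdmissibilityNotion}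

/-- Monotonicity in the admissibility notion (as for p4's door: a WEAKER `Adm` gives the stronger statement). [folklore] -/
theorem PerfectComplexDeformsOverSmoothChart.anti (hle : ∀ n X₀ I E, Adm' n X₀ I E → Adm n X₀ I E)
    (h : PerfectComplexDeformsOverSmoothChart C Adm) : PerfectComplexDeformsOverSmoothChart C Adm' :=
  fun _ _ π n hπ hS _ hU s₀ X₀ e κ I hobj hH => h π n hπ hS hU s₀ X₀ e κ I (hobj.mono hle) hH

end Chart

/-! ### §2b The PRINTED shape: deformation over an ÉTALE neighbourhood of `s₀` (implies the chart form, proved) -/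

section Etale

/-- **Local existence of an algebraic deformation over an ÉTALE NEIGHBOURHOOD of `s₀`** (schema in `Adm`;
assumption BY NAME of the venture) — the PRINTED conclusion shape: REFEREED in the proof of [Perry2022] Prop. 8.1
(«Since `𝓜° → U` is smooth and surjective, there exists a surjective étale morphism `U′ → U` with a point `0′ ∈ U′(ℂ)`
mapping to `0` … such that the base change `𝓜°_{U′} → U′` admits a section taking `0′` to `E_{0′}`» — an object
`E_{U′}` over the étale `U′` with `(E_{U′})_{0′} ≃ E₀`; `U` there = the OPEN image in `S` of the smooth locus `𝓜°`), and
Perry's 2026 Thm. 1.1, first bullet («deforms as a twisted perfect complex over an étale neighborhood of `0`», untwisted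
here). The TYPED shape is WEAKER than print on two counts (ref-3 P1 / red-4 v8): «surjective» is DROPPED (an étale `ρ`
through `s₀` suffices for the spread), and only the CLASSES `ch_p(ℰ|_{t₀})`, `p ∈ I`, are fixed (not `ℰ_{t₀} ≃ E₀`; Perry's
`φ` is a section of `K₀^top`, the tree carries Betti classes). (Buchweitz–Flenner's own proof of Thm. 5.1, p. 179,
outputs instead a CONVERGENT analytic section of the versal base — the CHART shape of §2; red-2 v15.) Same binders as
`PerfectComplexDeformsOverSmoothChart`; conclusion: an ÉTALE `ρ : T ⟶ S`, a point `t₀ ∈ T(ℂ)` over `s₀`, and a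
bounded complex of vector bundles `ℰ` on `𝒳 ×_S T` whose `ch_p` restricted to the fibre over `t₀`, carried to
`𝒳_{s₀}`, is `(e⁻¹)^* κ_p` for `p ∈ I`. For the intended `Adm`: on paper from (L1)–(L6), a smooth atlas
[Lieblich2006, Thm. 4.2.1], an étale quasi-section through the lift of `[E₀]` [EGAIV4, Cor. 17.16.3 (i)] (separability
void over `ℂ`; not the surjective form (ii)) and strictification [ThomasonTrobaugh1990, 2.3.1 (d)]; the kernel links it to
nothing. It implies the chart form (`….deformsOverSmoothChart`), hence p4's door. [cite: Perry2022, proof of Prop. 8.1]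
[cite: Lieblich2006, Thm. 4.2.1] [cite: EGAIV4, Cor. 17.16.3 (i)] [cite: ThomasonTrobaugh1990, Prop. 2.3.1 (d)]
[cite: BuchweitzFlenner2003, §5, proof of Thm. 5.1]
[cite: Pridham2024Semiregularity, Cor. 2.25, Rem. 2.27] [claim: Perry2026Semiregularity, status: under-review] -/
def PerfectComplexDeformsOverEtaleNbhd (C : ChernCharacterBetti) (Adm : AdmissibilityNotion) : Prop :=
  ∀ ⦃𝒳 S : SchemeOver ℂ⦄ (π : 𝒳 ⟶ S) (n : ℕ),
    IsSmoothProjectiveFamily π n → _root_.AlgebraicGeometry.Smooth S.hom →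
    ∀ ⦃U : Set (ComplexPoints S)⦄ (hU : IsCohomologicallyLocallyTrivialOn π U) (s₀ : U)
      (X₀ : SchemeOver ℂ) (e : X₀ ≅ fiberOver π s₀.1)
      (κ : ∀ p : ℕ, complexBetti X₀ (2 * p)) (I : Finset ℕ),
      perfectObjClass C Adm n X₀ I κ →
      (∀ p ∈ I, ∀ (t : U) (γ : Path.Homotopic.Quotient s₀ t),
          IsOfHodgeType n (fiberOver π t.1) (2 * p) p p
            (transportFun π (2 * p) hU γ (complexBetti.map e.inv (2 * p) (κ p)))) →
      ∃ (T : SchemeOver ℂ) (ρ : T ⟶ S) (_ : Etale ρ.left) (t₀ : ComplexPoints T)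
        (_ : AlgPoints.map ρ t₀ = s₀.1)
        (ℰ : CochainComplex (familyPullback π ρ).left.Modules ℤ) (hℰ : IsBoundedVBComplex ℰ),
        ∀ p ∈ I,
          FiberClass.baseChange π ρ (2 * p)
              (globalSection (familyPullback.snd π ρ) (2 * p)
                (chPerfect C (familyPullback π ρ) ℰ hℰ.isFiniteLocallyFree p) t₀) =
            ⟨s₀.1, complexBetti.map e.inv (2 * p) (κ p)⟩

variable {C : ChernCharacterBetti} {Adm Adm' : AdmissibilityNotion}

/-- Monotonicity in the admissibility notion. [folklore] -/
theorem PerfectComplexDeformsOverEtaleNbhd.anti (hle : ∀ n X₀ I E, Adm' n X₀ I E → Adm n X₀ I E)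
    (h : PerfectComplexDeformsOverEtaleNbhd C Adm) : PerfectComplexDeformsOverEtaleNbhd C Adm' :=
  fun _ _ π n hπ hS _ hU s₀ X₀ e κ I hobj hH => h π n hπ hS hU s₀ X₀ e κ I (hobj.mono hle) hH

/-- **Étale neighbourhood ⟹ smooth chart with a section** (proved): `ρ(ℂ)` is a local homeomorphism for `ρ` étale
(tree theorem `isLocalHomeomorph_map_of_etale`); its local inverse at `t₀` on `W :=` (chart target) `∩ U` is a continuous
section through `t₀`, and `T`, étale over the smooth `S`, is smooth over `ℂ`. [cite: SGA1, Exp. XII Prop. 3.1 (iii)] -/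
theorem PerfectComplexDeformsOverEtaleNbhd.deformsOverSmoothChart (h : PerfectComplexDeformsOverEtaleNbhd C Adm) :
    PerfectComplexDeformsOverSmoothChart C Adm := by
  intro 𝒳 S π n hπ hS U hU s₀ X₀ e κ I hobj hH
  obtain ⟨T, ρ, hρ, t₀, ht₀, ℰ, hℰ, hch⟩ := h π n hπ hS hU s₀ X₀ e κ I hobj hH
  haveI := hS; haveI := hρ
  have hT : _root_.AlgebraicGeometry.Smooth T.hom := by
    rw [← Over.w ρ]
    infer_instance
  obtain ⟨φ, ht₀φ, hφ⟩ := -- a chart of the local homeomorphism `ρ(ℂ)` at `t₀`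
    Literature.AlgebraicGeometry.FundamentalGroup.isLocalHomeomorph_map_of_etale ρ t₀
  have hφs₀ : φ t₀ = s₀.1 := by rw [← ht₀, hφ]
  have hs₀W : s₀.1 ∈ φ.target ∩ U := ⟨hφs₀ ▸ φ.map_source ht₀φ, s₀.2⟩
  let σ : C(↥(φ.target ∩ U), ComplexPoints T) :=
    ⟨fun w => φ.symm w.1, φ.continuousOn_symm.comp_continuous continuous_subtype_val fun w => w.2.1⟩
  have hσ : ∀ w : ↥(φ.target ∩ U), AlgPoints.map ρ (σ w) = w.1 := fun w => by
    change AlgPoints.map ρ (φ.symm w.1) = w.1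
    rw [hφ]
    exact φ.right_inv w.2.1
  have hσ₀ : σ ⟨s₀.1, hs₀W⟩ = t₀ := by
    change φ.symm s₀.1 = t₀
    rw [← hφs₀]
    exact φ.left_inv ht₀φ
  refine ⟨T, ρ, hT, φ.target ∩ U, φ.open_target.inter hU.isOpen, hs₀W, Set.inter_subset_right, σ, hσ, ℰ, hℰ,
    fun p hp => ?_⟩
  rw [hσ₀]; exact hch p hp

end Etale

/-! ### §3 The spread step: the chart assumption implies p4's door (proved) -/

section Spread

variable {C : ChernCharacterBetti} {Adm : AdmissibilityNotion}

/-- **THE ALGEBRAISATION / SPREAD STEP OF ROUTE (C), PROVED**: local existence of an algebraic deformation over a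
smooth chart ⟹ seat p4's door `PerfectComplexVariationalHodge C Adm`, for every `Adm`. The neighbourhood of the
conclusion is the domain `W` of the section; the transported class at `t ∈ W` is `ch_p` of `ℰ` restricted to the
fibre of `𝒳 ×_S T` over `σ(t)`. «Hence `α_p(s) = ch_p(ℱ|X_s)` is algebraic for all `s ∈ S` near `0` and each `p ∈ I`.»
[cite: BuchweitzFlenner2003, §5, proof of Thm. 5.1] [cite: VoisinHodgeII2003, §3.1.2] -/
theorem PerfectComplexDeformsOverSmoothChart.perfectComplexVariationalHodge
    (h : PerfectComplexDeformsOverSmoothChart C Adm) : PerfectComplexVariationalHodge C Adm := by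
  intro 𝒳 S π n hπ hS U hU s₀ X₀ e κ I hobj hH
  obtain ⟨T, ρ, hT, W, hWo, hW₀, hWU, σ, hσ, ℰ, hℰ, hch⟩ := h π n hπ hS hU s₀ X₀ e κ I hobj hH
  haveI := hS; haveI := hT
  exact ⟨W, hWo, hW₀, hWU, fun p hp t γ =>
    transportFun_mem_algebraicClasses_of_baseChange_chPerfect π ρ C hπ (hU.mono hWU hWo) σ hσ ℰ hℰ p γ
      (hch p hp)⟩

/-- **Route (C)'s transfer hypothesis from the chart assumption**: at `Adm := rankAdmissible C` (seat p4's REAL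
rank class), `PerfectComplexRankTransfer C` — the transfer hypothesis BY NAME of the g = 4 route-(C) theorems
`weilFourfoldsSplit_of_reach_of_perfectComplexRankTransfer_of_*` — follows; feed `hD.perfectComplexRankTransfer` for
their `hT`. [cite: BuchweitzFlenner2003, §5, proof of Thm. 5.1] -/
theorem PerfectComplexDeformsOverSmoothChart.perfectComplexRankTransfer
    (hD : PerfectComplexDeformsOverSmoothChart C (rankAdmissible C)) : PerfectComplexRankTransfer C :=
  (perfectComplexRankTransfer_iff C).2 hD.perfectComplexVariationalHodge

/-- **The printed (étale-neighbourhood) shape implies p4's door** (étale ⟹ chart with a section ⟹ spread).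
[cite: BuchweitzFlenner2003, §5, proof of Thm. 5.1] -/
theorem PerfectComplexDeformsOverEtaleNbhd.perfectComplexVariationalHodge
    (h : PerfectComplexDeformsOverEtaleNbhd C Adm) : PerfectComplexVariationalHodge C Adm :=
  h.deformsOverSmoothChart.perfectComplexVariationalHodge

/-- **Route (C)'s transfer hypothesis from the étale-neighbourhood assumption** at `Adm := rankAdmissible C`. [folklore] -/
theorem PerfectComplexDeformsOverEtaleNbhd.perfectComplexRankTransfer
    (h : PerfectComplexDeformsOverEtaleNbhd C (rankAdmissible C)) : PerfectComplexRankTransfer C :=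
  h.deformsOverSmoothChart.perfectComplexRankTransfer

end Spread

/-! ### §4 Sanity: a GLOBAL extension on `𝒳` gives the conclusion outright (no assumption) -/

section Global

variable (C : ChernCharacterBetti) {𝒳 S : SchemeOver ℂ} (π : 𝒳 ⟶ S)

/-- **Flat transport of the Chern character of a restricted complex**: for a bounded complex of vector bundles `ℱ`
on `𝒳`, the transport along any path in `U` of `ch_p(ℱ)|_{𝒳_s}` is `ch_p(ℱ|_{𝒳_t})` (restrictions of a global class
are flat). [cite: BuchweitzFlenner2003, §5, proof of Thm. 5.1] -/
theorem transportFun_map_fiberι_chPerfect {U : Set (ComplexPoints S)} (hU : IsCohomologicallyLocallyTrivialOn π U)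
    (ℱ : CochainComplex 𝒳.left.Modules ℤ) (hℱ : IsBoundedVBComplex ℱ) {s t : U}
    (γ : Path.Homotopic.Quotient s t) (p : ℕ) :
    transportFun π (2 * p) hU γ
        (complexBetti.map (fiberι π s.1) (2 * p) (chPerfect C 𝒳 ℱ hℱ.isFiniteLocallyFree p)) =
      chPerfect C (fiberOver π t.1) (((Scheme.Modules.pullback (fiberι π t.1).left).mapHomologicalComplex _).obj ℱ)
        (hℱ.pullback (fiberι π t.1).left).isFiniteLocallyFree p := by
  rw [transportFun_map_fiberι, map_chPerfect C 𝒳 _ hℱ p]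

/-- **The conclusion of p4's door with `W = U`, PROVED, when the complex extends over `𝒳` itself**: for a bounded
complex of vector bundles `ℱ` on `𝒳` with `(e⁻¹)^* κ_p = ch_p(ℱ)|_{𝒳_{s₀}}` for `p ∈ I`, the transports of `(e⁻¹)^* κ_p`
along paths in `U` are algebraic on every fibre reached — no admissibility, no Hodge hypothesis, no assumption (analogue
of the tree's `BuchweitzFlenner2003_variationalHodge_semiregular.conclusion_of_iso_pullback`; the CONTENT of the door
is the existence of such an extension near `s₀`). [cite: BuchweitzFlenner2003, §5, proof of Thm. 5.1]
[cite: Fulton1998, Prop. 19.1.2] -/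
theorem perfectComplexVariationalHodge_conclusion_of_global {n : ℕ} (hπ : IsSmoothProjectiveFamily π n)
    {U : Set (ComplexPoints S)} (hU : IsCohomologicallyLocallyTrivialOn π U) (s₀ : U)
    (X₀ : SchemeOver ℂ) (e : X₀ ≅ fiberOver π s₀.1) (κ : ∀ p : ℕ, complexBetti X₀ (2 * p)) (I : Finset ℕ)
    (ℱ : CochainComplex 𝒳.left.Modules ℤ) (hℱ : IsBoundedVBComplex ℱ)
    (hκ : ∀ p ∈ I, complexBetti.map e.inv (2 * p) (κ p) =
      complexBetti.map (fiberι π s₀.1) (2 * p) (chPerfect C 𝒳 ℱ hℱ.isFiniteLocallyFree p)) :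
    ∃ (W : Set (ComplexPoints S)) (hWo : IsOpen W) (hW₀ : s₀.1 ∈ W) (hWU : W ⊆ U),
      ∀ p ∈ I, ∀ (t : W) (γ : Path.Homotopic.Quotient (⟨s₀.1, hW₀⟩ : W) t),
        transportFun π (2 * p) (hU.mono hWU hWo) γ (complexBetti.map e.inv (2 * p) (κ p)) ∈
          algebraicClasses (fiberOver π t.1) p := by
  refine ⟨U, hU.isOpen, s₀.2, Set.Subset.rfl, fun p hp t γ => ?_⟩
  rw [hκ p hp, transportFun_map_fiberι_chPerfect C π _ ℱ hℱ γ p]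
  exact chPerfect_mem_algebraicClasses C _ (hπ.isSmoothProjective t.1) _ _ p

end Global

end Summit.Ventures.HSemireg

end
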